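import Summits.ResolutionOfSingularities.ResolutionOfSingularities.Theorems.EquisingularLiftEquisingularLiftNatUncentredConeGerm
import Summits.ResolutionOfSingularities.ResolutionOfSingularities.Theorems.EquisingularLiftEquisingularLiftNatCarrierDeltaFrameAdapted
import Summits.ResolutionOfSingularities.ResolutionOfSingularities.Theorems.EquisingularLiftEquisingularLiftNatDeltaConeLiftCentred
import Summits.ResolutionOfSingularities.ResolutionOfSingularities.Theorems.EquisingularLiftEquisingularLiftNatStrictTransformSquarefree
import Summits.ResolutionOfSingularities.ResolutionOfSingularities.Theorems.EquisingularLiftEquisingularLiftNatExceptionalTraceChartAlgebra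
import HarnessLib

/-!
# [OURS · L1 W4.5(b) · EL♮(3)] HSUB(ReachTC⁺) brick `inv_base`, part 2b-i (B4a lemmas): the value of a form at the origin of a chart of the
# blow-up algebra, and «`y′ ∈ Z` ⇒ the reduced tangent cone vanishes at `[1:0:0]` in a frame adapted to `y′`»

Crux chain w45b (cell `res-hironaka`, slot W4.5(b)), working crux **EL♮** = stmt-ResolutionOfSingularities-20038, child **EL♮(3)** =
stmt-ResolutionOfSingularities-20148, route EquisingularLift, line `sections`, registered stub `stub_elnat_tcPlusPointResolution`;
assembly HSUB(ReachTC⁺)₃ of res-L1-w45b-stub-1 (INV DEFS v3 p532383; brick `inv_base`, the CENTRED members `TCPlus.Member … {y′}`).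
HONEST FRAMING: OURS; NOT a statement of any manuscript; AI-written, weaker than expert review. No `sorry`; standard axioms.
`--supports stmt-ResolutionOfSingularities-20148 --as helper`. DEF-FREE.

WHAT (lemmas for part 2b-ii `exists_centredConeLift_three`).
* `eq_single_of_degree_eq`, `aeval_frac_sub_algebraMap_coeff_mem` — in the chart algebra `R[I/x₀]`, for a prime `𝔔 ∋ x₁/x₀, x₂/x₀`, a form
  `G` of degree `d` evaluated at `(x_j/x₀)_j` is congruent to its `T₀^d`-coefficient modulo `𝔔`.
* `X_dvd_chartU_one/two`, `X_dvd_chartV_one/two` — divisibility of the chart substitutions `(1, X₀, X₀X₁)`, `(1, X₀X₁, X₁)`.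
* **`coeff_mem_of_mem_carrierTrace`** — with the downstairs T-TCONE data at `x` (frame `c̄`, initial form `Φ₁`, square-free reduction `G`)
  and res-type-100's T-FRAME-AT presentation of `𝒪_{F₂,y′}` on the chart `c̄₀` with vanishing coordinates (packed), `y′ ∈ Z` forces
  `G_{d'e₀} ∈ (c̄)`, i.e. `ḡ(1,0,0) = 0` (res-L1-w45b-stub-2 `stalkIdeal_carrierTrace_of_presentation'`).
-/

set_option linter.dupNamespace false -- mandated namespace `Summit.<Summit>.<Problem>` of this single-conjunct summit
set_option linter.overlappingInstances false -- the binders carry `[IsDomain O] [IsDiscreteValuationRing O]`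

noncomputable section

open CategoryTheory CategoryTheory.Limits AlgebraicGeometry TopologicalSpace IsLocalRing
open Literature.AlgebraicGeometry.Resolution
open AlgebraicGeometry.Scheme.IdealSheafData
open Summit.ResolutionOfSingularities.ResolutionOfSingularities.Cruxes.EquisingularLift.StrataSplit

namespace Summit.ResolutionOfSingularities.ResolutionOfSingularities.Cruxes.EquisingularLiftNat.Sections

/-! ## Multiplicity of a form at `[1:0:…:0]` -/

section Multiplicity

variable {R : Type*} [CommRing R] {r : ℕ}

/-- A monomial exponent of degree `d` in `Fin 3` variables with `α₁ + α₂ = 0` is `d·e₀`. [folklore] -/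
theorem eq_single_of_degree_eq {d : ℕ} {α : Fin 3 →₀ ℕ} (hα : α.degree = d) (h0 : α 1 + α 2 = 0) : α = Finsupp.single 0 d := by
  ext i
  have h1 : α 1 = 0 := by omega
  have h2 : α 2 = 0 := by omega
  have hd : α 0 = d := by
    rw [← hα, Finsupp.degree_eq_sum, Fin.sum_univ_three]
    omega
  fin_cases i <;> simp [h1, h2, hd]

/-- **The value of a form at the chart origin.** In the chart algebra `B = R[I/x₀]` of a frame `x`, for a prime `𝔔` containing the chart
coordinates `x_l/x₀`, `l ≠ 0`, and lying over an ideal `𝔪 ⊇` the coefficients' residue test: a form `G` of degree `d` evaluated at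
`(x_j/x₀)_j` is congruent to its `T₀^d`-coefficient modulo `𝔔`. [folklore] -/
theorem aeval_frac_sub_algebraMap_coeff_mem {x : Fin 3 → R} {d : ℕ} (G : MvPolynomial (Fin 3) R) (hG : G.IsHomogeneous d)
    (𝔔 : Ideal (blowupAlgebra (Ideal.span (Set.range x)) (x 0)))
    (h𝔔 : ∀ l : Fin 3, l ≠ 0 → blowupAlgebra.frac x 0 l ∈ 𝔔) :
    MvPolynomial.aeval (blowupAlgebra.frac x 0) G - algebraMap R _ (G.coeff (Finsupp.single 0 d)) ∈ 𝔔 := by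
  classical
  have key : ∀ α ∈ G.support, α ≠ Finsupp.single 0 d →
      MvPolynomial.aeval (blowupAlgebra.frac x 0) (MvPolynomial.monomial α (G.coeff α)) ∈ 𝔔 := by
    intro α hα hne
    have hdeg : α.degree = d := by
      by_contra h
      exact (MvPolynomial.mem_support_iff.mp hα) (hG.coeff_eq_zero h)
    have hpos : α 1 + α 2 ≠ 0 := fun h0 => hne (eq_single_of_degree_eq hdeg h0)
    rw [MvPolynomial.aeval_monomial, Finsupp.prod_fintype _ _ (fun i => by rw [pow_zero]), Fin.prod_univ_three]
    refine Ideal.mul_mem_left _ _ ?_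
    rcases Nat.pos_iff_ne_zero.mpr hpos |> Nat.add_pos_iff_pos_or_pos.mp with h1 | h2
    · obtain ⟨e, he⟩ := Nat.exists_eq_succ_of_ne_zero h1.ne'
      rw [he, pow_succ]
      exact Ideal.mul_mem_right _ _ (Ideal.mul_mem_left _ _ (Ideal.mul_mem_left _ _ (h𝔔 1 (by decide))))
    · obtain ⟨e, he⟩ := Nat.exists_eq_succ_of_ne_zero h2.ne'
      rw [he, pow_succ]
      exact Ideal.mul_mem_left _ _ (Ideal.mul_mem_left _ _ (h𝔔 2 (by decide)))
  have hsingle : MvPolynomial.aeval (blowupAlgebra.frac x 0) (MvPolynomial.monomial (Finsupp.single (0 : Fin 3) d)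
      (G.coeff (Finsupp.single 0 d))) = algebraMap R _ (G.coeff (Finsupp.single 0 d)) := by
    have h1 : blowupAlgebra.frac x 0 0 = 1 := blowupAlgebra.gen_self _ _ _
    rw [MvPolynomial.aeval_monomial, Finsupp.prod_single_index (by rw [pow_zero]), h1, one_pow, mul_one]
  have hsum : MvPolynomial.aeval (blowupAlgebra.frac x 0) G =
      ∑ α ∈ G.support, MvPolynomial.aeval (blowupAlgebra.frac x 0) (MvPolynomial.monomial α (G.coeff α)) := by
    conv_lhs => rw [G.as_sum]
    rw [map_sum]
  rw [hsum]
  by_cases hmem : Finsupp.single (0 : Fin 3) d ∈ G.support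
  · rw [← Finset.add_sum_erase _ _ hmem, hsingle, add_sub_cancel_left]
    exact Ideal.sum_mem _ fun α hα => key α (Finset.mem_of_mem_erase hα) (Finset.ne_of_mem_erase hα)
  · have h0 : G.coeff (Finsupp.single 0 d) = 0 := MvPolynomial.notMem_support_iff.mp hmem
    rw [h0, map_zero, sub_zero]
    exact Ideal.sum_mem _ fun α hα => key α hα (fun h => hmem (h ▸ hα))

/-- `X₀ ∣ (1, X₀, X₀X₁)₁`. [folklore] -/
theorem X_dvd_chartU_one : (MvPolynomial.X 0 : MvPolynomial (Fin 2) R) ∣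
    (![1, MvPolynomial.X 0, MvPolynomial.X 0 * MvPolynomial.X 1] : Fin 3 → MvPolynomial (Fin 2) R) 1 := by simp

/-- `X₀ ∣ (1, X₀, X₀X₁)₂`. [folklore] -/
theorem X_dvd_chartU_two : (MvPolynomial.X 0 : MvPolynomial (Fin 2) R) ∣
    (![1, MvPolynomial.X 0, MvPolynomial.X 0 * MvPolynomial.X 1] : Fin 3 → MvPolynomial (Fin 2) R) 2 := by simp

/-- `X₁ ∣ (1, X₀X₁, X₁)₁`. [folklore] -/
theorem X_dvd_chartV_one : (MvPolynomial.X 1 : MvPolynomial (Fin 2) R) ∣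
    (![1, MvPolynomial.X 0 * MvPolynomial.X 1, MvPolynomial.X 1] : Fin 3 → MvPolynomial (Fin 2) R) 1 := by simp

/-- `X₁ ∣ (1, X₀X₁, X₁)₂`. [folklore] -/
theorem X_dvd_chartV_two : (MvPolynomial.X 1 : MvPolynomial (Fin 2) R) ∣
    (![1, MvPolynomial.X 0 * MvPolynomial.X 1, MvPolynomial.X 1] : Fin 3 → MvPolynomial (Fin 2) R) 2 := by simp

end Multiplicity

/-! ## `y′ ∈ Z` ⇒ the reduced tangent cone vanishes at `[1:0:0]` in a frame adapted to `y′` -/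

section Trace

set_option maxHeartbeats 400000 in -- the chart algebra `blowupAlgebra` is a subalgebra of a localisation: slow instance unification (cf. p509910)
/-- **On the trace, the form vanishes at the adapted point.** Downstairs data of T-TCONE at `x` (frame `c̄` with `(c̄) = 𝔪_x`, initial form
`Φ₁` of `W`, square-free reduction data `G` of degree `d'`) and res-type-100's T-FRAME-AT presentation of `𝒪_{F₂,y′}` on the chart `c̄₀`
with `c̄₁/c̄₀, c̄₂/c̄₀ ∈ 𝔔` (packed): if `y′` lies on the trace `Z = υ⁻¹{x} ∩ closure υ⁻¹(W ∖ {x})` then the `T₀^{d'}`-coefficient of `G` lies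
in `(c̄)` — i.e. `ḡ(1,0,0) = 0`: the stalk of `𝓘(Z)` at `y′` is `(χ G(c̄/c̄₀)) + (χ c̄₀)` (res-L1-w45b-stub-2 `stalkIdeal_carrierTrace_of_presentation'`)
and `G(c̄/c̄₀) ≡ G_{d'e₀}` modulo `𝔔`. [cite: StacksProject, Tag 0804] -/
theorem coeff_mem_of_mem_carrierTrace {F₁ F₂ : Scheme.{0}} [IsLocallyNoetherian F₂] {υ : F₂ ⟶ F₁} {x : F₁}
    (hx : IsClosed ({x} : Set F₁)) (y' : F₂) (hy'x : υ y' = x)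
    (cb : Fin 3 → F₁.presheaf.stalk x) (hc𝔪 : Ideal.span (Set.range cb) = maximalIdeal (F₁.presheaf.stalk x))
    (hc : IsQuasiRegular cb) (W : Closeds F₁) {d d' : ℕ} (Φ₁ G : MvPolynomial (Fin 3) (F₁.presheaf.stalk x))
    (hΦ₁d : Φ₁.IsHomogeneous d) (hΦ₁0 : MvPolynomial.map (Ideal.Quotient.mk (Ideal.span (Set.range cb))) Φ₁ ≠ 0)
    (hW : stalkIdeal (vanishingIdeal W) x = Ideal.span {MvPolynomial.eval cb Φ₁})
    (hR1 : MvPolynomial.map (Ideal.Quotient.mk (Ideal.span (Set.range cb))) Φ₁ ∈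
      (Ideal.span {MvPolynomial.map (Ideal.Quotient.mk (Ideal.span (Set.range cb))) G}).radical)
    (hR1' : MvPolynomial.map (Ideal.Quotient.mk (Ideal.span (Set.range cb))) G ∈
      (Ideal.span {MvPolynomial.map (Ideal.Quotient.mk (Ideal.span (Set.range cb))) Φ₁}).radical)
    (hR2 : ∀ j, (Ideal.span {MvPolynomial.map (Ideal.Quotient.mk (Ideal.span (Set.range cb))) (dehomogenize j G)}).IsRadical)
    (hGd' : G.IsHomogeneous d')
    (hZ : IsClosed (υ ⁻¹' {x} ∩ closure (υ ⁻¹' ((W : Set F₁) \ {x}))))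
    (hy' : y' ∈ υ ⁻¹' {x} ∩ closure (υ ⁻¹' ((W : Set F₁) \ {x})))
    (Hp : ∃ (𝔔 : PrimeSpectrum (blowupAlgebra (Ideal.span (Set.range cb)) (cb 0)))
        (χ : blowupAlgebra (Ideal.span (Set.range cb)) (cb 0) →+* F₂.presheaf.stalk y')
        (e : F₂.presheaf.stalk y' ≃+* Localization.AtPrime 𝔔.asIdeal),
        (∀ a, χ (algebraMap _ _ a) = ((F₁.presheaf.stalkCongr (Inseparable.of_eq hy'x)).inv ≫ υ.stalkMap y').hom a) ∧
        @IsLocalization.AtPrime _ _ (F₂.presheaf.stalk y') _ χ.toAlgebra 𝔔.asIdeal _ ∧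
        (∀ b, e (χ b) = algebraMap _ (Localization.AtPrime 𝔔.asIdeal) b) ∧
        𝔔.asIdeal.comap (algebraMap _ (blowupAlgebra (Ideal.span (Set.range cb)) (cb 0))) = maximalIdeal (F₁.presheaf.stalk x) ∧
        ∀ (l : {l : Fin 3 // l ≠ 0}) (y : blowupAlgebra (Ideal.span (Set.range cb)) (cb 0)),
          (y : Localization.Away (cb 0)) = algebraMap _ (Localization.Away (cb 0)) (cb l.1) * IsLocalization.Away.invSelf (cb 0) →
            y ∈ 𝔔.asIdeal) :
    G.coeff (Finsupp.single 0 d') ∈ Ideal.span (Set.range cb) := by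
  subst hy'x
  refine Hp.elim fun 𝔔 H => H.elim fun χ H => H.elim fun e H => ?_
  have hχ := H.1
  have he := H.2.2.1
  have h𝔔 := H.2.2.2.1
  have hvan := H.2.2.2.2
  have hfrac : ∀ l : Fin 3, l ≠ 0 → blowupAlgebra.frac cb 0 l ∈ 𝔔.asIdeal :=
    fun l hl => hvan ⟨l, hl⟩ _ (blowupAlgebra.coe_frac _ 0 l)
  have hy'Z : y' ∈ (vanishingIdeal (⟨υ ⁻¹' {υ y'} ∩ closure (υ ⁻¹' ((W : Set F₁) \ {υ y'})), hZ⟩ : Closeds F₂)).support := by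
    rw [← SetLike.mem_coe, Literature.AlgebraicGeometry.Resolution.coe_support_vanishingIdeal, Closeds.coe_mk]
    exact hy'
  have hst := stalkIdeal_carrierTrace_of_presentation' hx y' rfl cb hc𝔪 hc W Φ₁ G hΦ₁d hΦ₁0 hW hR1 hR1' hR2 hZ 0 𝔔 χ e
    (fun a => by rw [hχ, stalkCongr_of_eq_refl_apply]; simp [TopCat.Presheaf.stalkCongr]) he
  have hG𝔔 : MvPolynomial.aeval (blowupAlgebra.frac cb 0) G ∈ 𝔔.asIdeal := by
    have h := (mem_support_iff_stalkIdeal_le _ y').mp hy'Z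
    rw [hst, sup_le_iff, Ideal.span_singleton_le_iff_mem] at h
    exact (chi_mem_maximalIdeal_iff 𝔔 χ e he _).mp h.1
  have halg : algebraMap _ _ (G.coeff (Finsupp.single 0 d')) ∈ 𝔔.asIdeal := by
    have h := Ideal.sub_mem _ hG𝔔 (aeval_frac_sub_algebraMap_coeff_mem (x := cb) G hGd' 𝔔.asIdeal hfrac)
    rwa [sub_sub_cancel] at h
  have h3 := Ideal.mem_comap.mpr halg
  rw [h𝔔] at h3
  rw [hc𝔪]
  exact h3

end Trace

end Summit.ResolutionOfSingularities.ResolutionOfSingularities.Cruxes.EquisingularLiftNat.Sections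

end
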